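import Mathlib

/-!
# SoloBlind — no level-free 2-adic denominator functional (LEMMA D of the solo-blind programme, s36)

`paper/hafnian-theorem.md` §12.6.  A *denominator functional* is an additive map on formal sums of
elements of `ℚ/ℤ` of the form `Σ mₓ [x] ↦ Σ mₓ φ(den x)` for some `φ : ℕ → A`; `den x` is the denominator
of (any lift of) `x`, i.e. `Rat.den`.  Aoki's parametric family F1 of coincident Fermat triples contains,
for every parameter `x`, the pair `(x, x, -2x)` and `(x, ½ - x, ½)` (Legendre's duplication formula); an
invariant that is constant on coincidence classes at ALL levels must take equal values on the two members.

LEMMA D.  If `Σφ` agrees on the two members for every `x` with `4 ∣ den x`, then `φ` is constant on the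
even numbers (`φ e = φ 2`; witness `x = 1/(2e)`: the members have denominators `(2e, 2e, e)` and
`(2e, 2e, 2)`).  If moreover `φ` kills one multiplication-by-2 relation `[1/M] + [1/M + ½] - [2/M]` at a
level `M` with `4 ∣ M` (denominators `M, M, M/2`), then `φ` vanishes on all even denominators — it is an
odd-denominator functional.  Consequently the 2-adic (`v₂(den) = 2`) bit family of THEOREM H₂ admits no
level-free extension (it is "level-bound" intrinsically).

* `den_one_div`, `den_neg_two_mul`, `den_half_sub`, `den_one_div_add_half`, `den_two_div` — the five
  denominator computations;
* `even_den_const` — first part of LEMMA D (any additive group `A`, in fact any type with `+`: only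
  cancellation is used, so we state it for an `AddCommGroup`);
* `even_den_zero` — second part.
-/

namespace Summit.KontsevichZagierPeriods.KontsevichZagierPeriods.Theorems
namespace SoloBlind
namespace DenominatorFunctional

/-- Denominator of `a / b` for coprime `a : ℤ`, `b : ℕ`, `0 < b`. -/
theorem den_eq_of_coprime {a : ℤ} {b : ℕ} (hb : 0 < b) (h : Nat.Coprime a.natAbs b) (q : ℚ)
    (hq : q = (a : ℚ) / (b : ℚ)) : q.den = b := by
  subst hq
  have h' := Rat.den_div_eq_of_coprime (a := a) (b := (b : ℤ)) (by exact_mod_cast hb) (by simpa using h)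
  have h'' : ((((a : ℚ) / ((b : ℤ) : ℚ)).den : ℤ)) = ((b : ℕ) : ℤ) := h'
  have : ((a : ℚ) / ((b : ℤ) : ℚ)) = (a : ℚ) / (b : ℚ) := by push_cast; rfl
  rw [this] at h''
  exact_mod_cast h''

/-- `den (1/n) = n` for `n ≠ 0`. -/
theorem den_one_div (n : ℕ) (hn : n ≠ 0) : ((1 : ℚ) / n).den = n := by
  refine den_eq_of_coprime (a := 1) (Nat.pos_of_ne_zero hn) (by simp) _ ?_
  push_cast; rfl

/-- `den (-2 · 1/(2e)) = e` for `e ≠ 0`. -/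
theorem den_neg_two_mul (e : ℕ) (he : e ≠ 0) : (-2 * ((1 : ℚ) / (2 * e))).den = e := by
  refine den_eq_of_coprime (a := -1) (Nat.pos_of_ne_zero he) (by simp) _ ?_
  have : (e : ℚ) ≠ 0 := by exact_mod_cast he
  push_cast
  field_simp
  try ring

/-- `den (½ - 1/(2(m+1))) = 2(m+1)` for `m` odd (so `e = m + 1` is even):
`½ - 1/(2(m+1)) = m / (2(m+1))` and `gcd(m, 2(m+1)) = 1`. -/
theorem den_half_sub (m : ℕ) (hm : Odd m) :
    ((1 : ℚ) / 2 - 1 / (2 * ((m : ℚ) + 1))).den = 2 * (m + 1) := by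
  have hcop : Nat.Coprime m (2 * (m + 1)) := by
    refine Nat.Coprime.mul_right ?_ ?_
    · have h2 : ¬ 2 ∣ m := by
        rintro ⟨k, hk⟩; obtain ⟨j, hj⟩ := hm; omega
      exact ((Nat.Prime.coprime_iff_not_dvd Nat.prime_two).mpr h2).symm
    · have : Nat.Coprime m (1 + m) := (Nat.coprime_add_self_right).mpr (Nat.coprime_one_right m)
      rwa [add_comm] at this
  refine den_eq_of_coprime (a := (m : ℤ)) (b := 2 * (m + 1)) (by positivity) (by simpa using hcop) _ ?_
  have : ((m : ℚ) + 1) ≠ 0 := by positivity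
  push_cast
  field_simp
  try ring

/-- `den (1/M + ½) = M` for `M = 4k`, `k ≠ 0`: `1/(4k) + ½ = (2k+1)/(4k)`, `gcd(2k+1, 4k) = 1`. -/
theorem den_one_div_add_half (k : ℕ) (hk : k ≠ 0) :
    ((1 : ℚ) / (4 * k) + 1 / 2).den = 4 * k := by
  have hcop : Nat.Coprime (2 * k + 1) (4 * k) := by
    have h4 : (4 * k) = 2 * 2 * k := by ring
    rw [h4]
    refine Nat.Coprime.mul_right (Nat.Coprime.mul_right ?_ ?_) ?_
    · exact ((Nat.Prime.coprime_iff_not_dvd Nat.prime_two).mpr (by omega)).symm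
    · exact ((Nat.Prime.coprime_iff_not_dvd Nat.prime_two).mpr (by omega)).symm
    · -- gcd(2k+1, k) = 1
      have : Nat.Coprime k (2 * k + 1) := by
        have h1 : Nat.gcd k (2 * k + 1) ∣ k := Nat.gcd_dvd_left _ _
        have h2 : Nat.gcd k (2 * k + 1) ∣ 2 * k + 1 := Nat.gcd_dvd_right _ _
        have h3 : Nat.gcd k (2 * k + 1) ∣ 2 * k := Dvd.dvd.mul_left h1 2
        have h4 : Nat.gcd k (2 * k + 1) ∣ 1 := (Nat.dvd_add_right h3).mp h2
        exact Nat.coprime_iff_gcd_eq_one.mpr (Nat.dvd_one.mp h4)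
      exact this.symm
  refine den_eq_of_coprime (a := ((2 * k + 1 : ℕ) : ℤ)) (b := 4 * k) (by positivity)
    (by rw [Int.natAbs_natCast]; exact hcop) _ ?_
  have : (k : ℚ) ≠ 0 := by exact_mod_cast hk
  push_cast
  field_simp
  try ring

/-- `den (2/M) = M/2` for `M = 4k`, `k ≠ 0`: `2/(4k) = 1/(2k)`. -/
theorem den_two_div (k : ℕ) (hk : k ≠ 0) : ((2 : ℚ) / (4 * k)).den = 2 * k := by
  refine den_eq_of_coprime (a := 1) (b := 2 * k) (by positivity) (by simp) _ ?_
  have : (k : ℚ) ≠ 0 := by exact_mod_cast hk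
  push_cast
  field_simp
  try ring

/-- `den (1/2) = 2`. -/
theorem den_half : ((1 : ℚ) / 2).den = 2 := by
  have := den_one_div 2 (by norm_num)
  push_cast at this
  exact this

/-- **LEMMA D, first part.**  If the denominator functional `Σφ∘den` takes equal values on the two members
`(x, x, -2x)`, `(x, ½ - x, ½)` of the F1 pair for every rational `x` with `4 ∣ den x`, then `φ` is constant
on the even positive integers. -/
theorem even_den_const {A : Type*} [AddCommGroup A] (φ : ℕ → A)
    (hF1 : ∀ x : ℚ, 4 ∣ x.den →
      φ x.den + φ x.den + φ (-2 * x).den = φ x.den + φ ((1 : ℚ) / 2 - x).den + φ ((1 : ℚ) / 2).den)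
    (e : ℕ) (he : Even e) (he0 : e ≠ 0) : φ e = φ 2 := by
  obtain ⟨j, hj⟩ := he
  -- e = j + j, j ≠ 0; write e = m + 1 with m = 2j - 1 odd
  have hj0 : j ≠ 0 := by rintro rfl; simp at hj; exact he0 hj
  obtain ⟨m, hm, hme⟩ : ∃ m : ℕ, Odd m ∧ e = m + 1 := ⟨e - 1, ⟨j - 1, by omega⟩, by omega⟩
  -- the witness x = 1/(2e)
  set x : ℚ := (1 : ℚ) / (2 * e) with hx
  have hxden : x.den = 2 * e := by
    have := den_one_div (2 * e) (by omega)
    simpa [hx] using this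
  have h4 : 4 ∣ x.den := by rw [hxden, hj]; exact ⟨j, by ring⟩
  have h2x : (-2 * x).den = e := by rw [hx]; exact den_neg_two_mul e he0
  have hhalf : ((1 : ℚ) / 2 - x).den = 2 * e := by
    have := den_half_sub m hm
    have hcast : (2 * ((m : ℚ) + 1)) = 2 * (e : ℚ) := by rw [hme]; push_cast; ring
    rw [hcast] at this
    rw [hx, this, hme]
  have key := hF1 x h4
  rw [h2x, hhalf, hxden, den_half] at key
  -- φ(2e) + φ(2e) + φ e = φ(2e) + φ(2e) + φ 2
  exact add_left_cancel key

/-- **LEMMA D, second part.**  If in addition `φ` kills one multiplication-by-2 relation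
`[1/M] + [1/M + ½] - [2/M]` at a level `M = 4k` (i.e. `φ M + φ M = φ (M/2)` through the denominators
`den(1/M) = den(1/M + ½) = M`, `den(2/M) = M/2`), then `φ` vanishes on every even positive integer:
a denominator functional that is constant on the F1 pairs at all levels and kills the relations of one
level divisible by `4` is a functional of the odd denominators alone. -/
theorem even_den_zero {A : Type*} [AddCommGroup A] (φ : ℕ → A)
    (hF1 : ∀ x : ℚ, 4 ∣ x.den →
      φ x.den + φ x.den + φ (-2 * x).den = φ x.den + φ ((1 : ℚ) / 2 - x).den + φ ((1 : ℚ) / 2).den)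
    (hMU : ∃ k : ℕ, k ≠ 0 ∧
      φ ((1 : ℚ) / (4 * k)).den + φ ((1 : ℚ) / (4 * k) + 1 / 2).den = φ ((2 : ℚ) / (4 * k)).den)
    (e : ℕ) (he : Even e) (he0 : e ≠ 0) : φ e = 0 := by
  obtain ⟨k, hk, hrel⟩ := hMU
  have hM : ((1 : ℚ) / (4 * k)).den = 4 * k := by
    have := den_one_div (4 * k) (by omega); simpa using this
  rw [hM, den_one_div_add_half k hk, den_two_div k hk] at hrel
  -- φ(4k) = φ 2 = φ(2k) by the first part
  have hA : φ (4 * k) = φ 2 := even_den_const φ hF1 (4 * k) ⟨2 * k, by ring⟩ (by omega)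
  have hB : φ (2 * k) = φ 2 := even_den_const φ hF1 (2 * k) ⟨k, by ring⟩ (by omega)
  have hE : φ e = φ 2 := even_den_const φ hF1 e he he0
  rw [hA, hB] at hrel
  -- φ 2 + φ 2 = φ 2  ⇒  φ 2 = 0
  have : φ 2 = 0 := by
    have h := hrel
    have : φ 2 + φ 2 - φ 2 = φ 2 - φ 2 := by rw [h]
    simpa using this
  rw [hE, this]

end DenominatorFunctional
end SoloBlind
end Summit.KontsevichZagierPeriods.KontsevichZagierPeriods.Theorems
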